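import Summits.ResolutionOfSingularities.ResolutionOfSingularities.Theorems.WeightedInvariantContactFiltrationEssSmoothLevels
import Summits.ResolutionOfSingularities.ResolutionOfSingularities.Theorems.WeightedInvariantContactFiltrationTerminal
import Summits.ResolutionOfSingularities.ResolutionOfSingularities.Theorems.WeightedInvariantContactFiltrationUnboundedLevel
import Literature.AlgebraicGeometry.Resolution.RegularLocalRingsQuotient
import HarnessLib

/-!
# (c11)≤3 for the flat centre filtration `J₃ᵗ = Iota3.jFlatT`, PART 6a — descent of the terminal contact level REDUCED
# to rational corrections of the contact parameter, in EVERY dimension (door `HypersurfaceCentreConstruction`,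
# stmt-ResolutionOfSingularities-19897; P3 rung clause (c11)≤3; ORDER (o53) PART 6 = GAP 1′ of res-L1-w43-plan-1's DEAL
# 2026-08-27T16:09:06Z, hand res-L1-w43-stub-3)

Topic: `Summits/ResolutionOfSingularities/ResolutionOfSingularities/Theorems`. Helper for the door item
`HypersurfaceCentreConstruction` (stmt-ResolutionOfSingularities-19897, route `WeightedInvariant`), line `local-engine`
(L W4.3), def-free.  GAP 1′ of PART 5 (`jFlatT_map_of_bMax_of_sigma`, hypothesis `hB`) is the equality
`bMax (φ f) = bMax f` of the terminal contact levels along a local, formally smooth, essentially-of-finite-type homomorphism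
`φ : S → S'` of regular local rings with `𝔪_S S' = 𝔪_{S'}` — res-type-078/070's `EssSmoothLevels.bMax_map_eq` (p518970)
WITHOUT its «dimension two» hypotheses.  Ascent of reached levels is free (`reaches_map`); THIS FILE reduces DESCENT, in every
dimension, to the existence of RATIONAL CORRECTIONS of the contact parameter:

* §1 `contactFiltration_eq_of_sub_unit_mul_mem_pow` — two contact parameters congruent up to a unit modulo `𝔪^c` define
  the same weight-`c` filtration (res-type-078's `contactFiltration_le_of_mem_span_sup_pow`, p511384, both ways).
* §2 `exists_unit_sub_mul_mem_pow_of_levels` — NORMALISATION at `b ≥ 2`: if `y` carries `f` to level `b` and `g` carries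
  `f` to level `b + 1` then `g = u y + r` with `u` a unit and `r ∈ 𝔪^b` (C2 key step `mem_span_sup_pow_of_mem_contactFiltration`
  + the unit step `exists_unit_sub_mul_mem_pow`, p520252 — any dimension).
* §3 **`reaches_succ_of_correction`** — if `g' ∈ S'` carries `φ f` to level `b + 1` and `g' ≡ u · φ(y + r) (mod 𝔪'^{b+1})`
  for some `r ∈ 𝔪_S` with `y + r ∉ 𝔪²` and a unit `u`, then `f` reaches level `b + 1` in `S` (via `y + r`).
* §4 **`reaches_map_iff_of_corrections`, `bMax_map_eq_of_corrections`** — if EVERY pair (`y` a level-`b` parameter of `f` in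
  `S`, `g'` a level-`(b+1)` parameter of `φ f` in `S'`) admits such a rational correction, then `Reaches (φ f) ν b ↔ Reaches f ν b`
  for all `b ≥ 1` and `bMax (φ f) = bMax f` (the text of `EssSmoothLevels.reaches_map_iff` / `bMax_map_eq` with the
  two-dimensional descent step replaced by the hypothesis).

What is LEFT of GAP 1′ after this file (GAP 1″, for PART 6b): the rational corrections themselves — by §2 only the class of
`r' := g' − u · φ y` in `𝔪'^b ⧸ ((φ y) 𝔪'^{b-1} + 𝔪'^{b+1}) = k' ⊗_k (degree-`b` forms of `gr (S ⧸ (y))`) has to be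
`k`-RATIONAL, which is the ν-th-power («solvable vertex») computation on the level-`b` face of `f` plus the residue-field lemma
(`k'/k` separable) — res-type-078/070's `reaches_succ_of_faces` in coordinates `(x₁, …, x_{d-1}, y)`.

[OURS · L1 W4.3 · (o53)]  Replaces the role of NO printed item; NOT a statement of the manuscript
[claim: Hironaka2017, status: under-review]. AI work, weaker than expert review.  Pure commutative algebra; no named facts.

## References

* H. Hironaka, *Characteristic polyhedra of singularities*, J. Math. Kyoto Univ. 7 (1967) 251–293. [Hironaka1967]
* H. Matsumura, *Commutative Ring Theory* (1987), §22, Thm. 23.7. [Matsumura1987]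
-/

noncomputable section

open IsLocalRing Literature.AlgebraicGeometry.Resolution
open Summit.ResolutionOfSingularities.ResolutionOfSingularities.Cruxes.HypersurfaceCentreConstruction.LocalEngine

set_option linter.dupNamespace false -- mandated namespace of this single-conjunct summit

namespace Summit.ResolutionOfSingularities.ResolutionOfSingularities.Theorems

namespace JFlatEssSmooth

open IotaOrderEssSmooth (mem_maximalIdeal_pow_iff_of_formallySmooth adicOrder_algebraMap_eq_of_formallySmooth)

/-! ## §1 Congruent parameters define the same filtration -/

section OneRing

variable {S : Type} [CommRing S] [IsRegularLocalRing S]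

/-- **Two contact parameters congruent up to a unit modulo `𝔪^c` define the same weight-`c` filtration**:
`g₁ - u g₂ ∈ 𝔪^c`, `u` a unit ⇒ `contactFiltration g₁ c n = contactFiltration g₂ c n` for every `n`.
[cite: Hironaka1967, Thm. (well-preparedness)] -/
theorem contactFiltration_eq_of_sub_unit_mul_mem_pow {g₁ g₂ u : S} (hu : IsUnit u) {c : ℕ}
    (h : g₁ - u * g₂ ∈ maximalIdeal S ^ c) (n : ℕ) : contactFiltration g₁ c n = contactFiltration g₂ c n := by
  have h₁ : g₁ ∈ Ideal.span {g₂} ⊔ maximalIdeal S ^ c := by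
    have : g₁ = u * g₂ + (g₁ - u * g₂) := by ring
    rw [this]
    exact Submodule.add_mem_sup (Ideal.mem_span_singleton'.mpr ⟨u, rfl⟩) h
  have h₂ : g₂ ∈ Ideal.span {g₁} ⊔ maximalIdeal S ^ c := by
    obtain ⟨v, hv⟩ := hu.exists_left_inv
    have : g₂ = v * g₁ + (-(v * (g₁ - u * g₂))) := by
      rw [mul_sub, ← mul_assoc, hv, one_mul]; ring
    rw [this]
    exact Submodule.add_mem_sup (Ideal.mem_span_singleton'.mpr ⟨v, rfl⟩) (neg_mem (Ideal.mul_mem_left _ v h))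
  rw [contactFiltration_def, contactFiltration_def]
  exact le_antisymm (ContactFiltration.contactFiltration_le_of_mem_span_sup_pow h₁ n)
    (ContactFiltration.contactFiltration_le_of_mem_span_sup_pow h₂ n)

/-! ## §2 Normalisation of a better parameter at `b ≥ 2` -/

/-- **NORMALISATION**: if `y ∈ 𝔪 ∖ 𝔪²` carries `f` (`f ∉ 𝔪^{ν+1}`, `ν ≥ 1`) to level `b ≥ 2` and `g ∈ 𝔪 ∖ 𝔪²` carries `f` to
level `b + 1`, then `g = u y + r` with `u` a unit and `r ∈ 𝔪^b` (level `b + 1` lies in level `b`; C2's key step and the unit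
step, res-type-078, any dimension). [cite: Hironaka1967, Thm. (well-preparedness)] -/
theorem exists_unit_sub_mul_mem_pow_of_levels {y g : S} (hy : y ∈ maximalIdeal S) (hy2 : y ∉ maximalIdeal S ^ 2)
    (hg : g ∈ maximalIdeal S) (hg2 : g ∉ maximalIdeal S ^ 2) {b ν : ℕ} (hb : 2 ≤ b) (hν : 1 ≤ ν) {f : S}
    (hford : f ∉ maximalIdeal S ^ (ν + 1)) (hfy : f ∈ contactFiltration y b (b * ν))
    (hfg : f ∈ contactFiltration g (b + 1) ((b + 1) * ν)) :
    ∃ u : Sˣ, g - u * y ∈ maximalIdeal S ^ b := by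
  have hfg' : f ∈ contactFiltration g b (b * ν) := by
    rw [contactFiltration_def] at hfg ⊢
    exact ContactFiltration.contactFiltration_succ_level_le g b ν hfg
  rw [contactFiltration_def] at hfy hfg'
  exact ContactFiltration.exists_unit_sub_mul_mem_pow hg2 hy hb
    (ContactFiltration.mem_span_sup_pow_of_mem_contactFiltration hg hy hy2 hb hν hford hfg' hfy)

end OneRing

/-! ## §3 Descent of one level from a rational correction -/

section Descent

variable {S S' : Type} [CommRing S] [CommRing S'] [IsRegularLocalRing S] [IsRegularLocalRing S'] [Algebra S S']
  [IsLocalHom (algebraMap S S')] [Algebra.FormallySmooth S S'] [Algebra.EssFiniteType S S']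

/-- **DESCENT OF ONE LEVEL FROM A RATIONAL CORRECTION.**  `φ : S → S'` local, formally smooth, essentially of finite type between
regular local rings with `𝔪_S S' = 𝔪_{S'}`; `g' ∈ S'` carries `φ f` to level `b + 1`; and `g' ≡ u · φ(y + r) (mod 𝔪'^{b+1})`
for `y, r ∈ 𝔪_S` with `y + r ∉ 𝔪_S²` and a unit `u ∈ S'`.  Then `f` reaches level `b + 1` in `S`, via `y + r`
(§1: `g'` and `φ(y + r)` define the same weight-`(b+1)` filtration; membership is reflected by faithful flatness,
`EssSmoothLevels.algebraMap_mem_contactFiltration_iff`). [OURS · L1 W4.3 · (o53) GAP 1′] -/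
theorem reaches_succ_of_correction (h𝔪 : (maximalIdeal S).map (algebraMap S S') = maximalIdeal S') {f : S} {ν b : ℕ}
    {y r : S} (hy : y ∈ maximalIdeal S) (hr : r ∈ maximalIdeal S) (hyr2 : y + r ∉ maximalIdeal S ^ 2) {g' : S'}
    (hfg' : algebraMap S S' f ∈ contactFiltration g' (b + 1) ((b + 1) * ν)) {u : S'} (hu : IsUnit u)
    (hcong : g' - u * algebraMap S S' (y + r) ∈ maximalIdeal S' ^ (b + 1)) : Reaches f ν (b + 1) := by
  refine ⟨y + r, Ideal.add_mem _ hy hr, hyr2, ?_⟩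
  rw [← EssSmoothLevels.algebraMap_mem_contactFiltration_iff h𝔪 f (y + r) (b + 1) _,
    ← contactFiltration_eq_of_sub_unit_mul_mem_pow hu hcong]
  exact hfg'

/-! ## §4 The reduction: levels and the terminal level descend from rational corrections -/

/-- **The contact levels of `f` and `φ f` coincide, GIVEN rational corrections** (`b ≥ 1`): ascent by transport
(`EssSmoothLevels.reaches_map`); descent by induction on the level — each step `b ↦ b + 1` uses a level-`b` parameter `y` of `f`
in `S` (induction hypothesis), a level-`(b+1)` parameter `g'` of `φ f` in `S'`, and the hypothesis `hcorr` that `g'` is congruent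
up to a unit modulo `𝔪'^{b+1}` to the image of a regular parameter `y + r` of `S` (§3).  This is res-type-078/070's
`EssSmoothLevels.reaches_map_iff` with the two-dimensional descent step abstracted. [OURS · L1 W4.3 · (o53) GAP 1′] -/
theorem reaches_map_iff_of_corrections (h𝔪 : (maximalIdeal S).map (algebraMap S S') = maximalIdeal S')
    (h𝔪0 : maximalIdeal S ≠ ⊥) {f : S} {ν : ℕ} (hfν : f ∈ maximalIdeal S ^ ν)
    (hcorr : ∀ b : ℕ, 1 ≤ b → ∀ y : S, y ∈ maximalIdeal S → y ∉ maximalIdeal S ^ 2 →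
      f ∈ contactFiltration y b (b * ν) → ∀ g' : S', g' ∈ maximalIdeal S' → g' ∉ maximalIdeal S' ^ 2 →
      algebraMap S S' f ∈ contactFiltration g' (b + 1) ((b + 1) * ν) →
      ∃ (r : S) (u : S'), r ∈ maximalIdeal S ∧ y + r ∉ maximalIdeal S ^ 2 ∧ IsUnit u ∧
        g' - u * algebraMap S S' (y + r) ∈ maximalIdeal S' ^ (b + 1))
    {b : ℕ} (hb : 1 ≤ b) : Reaches (algebraMap S S' f) ν b ↔ Reaches f ν b := by
  refine ⟨fun h => ?_, EssSmoothLevels.reaches_map h𝔪⟩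
  induction b, hb using Nat.le_induction with
  | base => exact reaches_one hfν (exists_mem_maximalIdeal_not_mem_sq h𝔪0)
  | succ b hb ih =>
    obtain ⟨y, hy, hy2, hfy⟩ := ih (h.of_le (Nat.le_succ b))
    obtain ⟨g', hg', hg'2, hfg'⟩ := h
    obtain ⟨r, u, hr, hyr2, hu, hcong⟩ := hcorr b hb y hy hy2 hfy g' hg' hg'2 hfg'
    exact reaches_succ_of_correction h𝔪 hy hr hyr2 hfg' hu hcong

/-- **THE TERMINAL LEVEL DESCENDS FROM RATIONAL CORRECTIONS**: under the hypothesis `hcorr` of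
`reaches_map_iff_of_corrections` (with `ν = ord f`), `bMax (φ f) = bMax f` for `f ∈ 𝔪 ∖ 0` — the two `sSup`s range over the
same set of levels and `ord (φ f) = ord f` (res-type-070, p503771).  This is `EssSmoothLevels.bMax_map_eq` (p518970) with its
two-dimensional descent step abstracted into `hcorr`; PART 5's GAP 1′ is thereby GAP 1″ = `hcorr` at equal dimension three.
[OURS · L1 W4.3 · (o53) GAP 1′] -/
theorem bMax_map_eq_of_corrections (h𝔪 : (maximalIdeal S).map (algebraMap S S') = maximalIdeal S') {f : S} (hf0 : f ≠ 0)
    (hf : f ∈ maximalIdeal S)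
    (hcorr : ∀ b : ℕ, 1 ≤ b → ∀ y : S, y ∈ maximalIdeal S → y ∉ maximalIdeal S ^ 2 →
      f ∈ contactFiltration y b (b * (adicOrder f).toNat) → ∀ g' : S', g' ∈ maximalIdeal S' → g' ∉ maximalIdeal S' ^ 2 →
      algebraMap S S' f ∈ contactFiltration g' (b + 1) ((b + 1) * (adicOrder f).toNat) →
      ∃ (r : S) (u : S'), r ∈ maximalIdeal S ∧ y + r ∉ maximalIdeal S ^ 2 ∧ IsUnit u ∧
        g' - u * algebraMap S S' (y + r) ∈ maximalIdeal S' ^ (b + 1)) :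
    bMax (algebraMap S S' f) = bMax f := by
  have h𝔪0 : maximalIdeal S ≠ ⊥ := fun h => hf0 ((Submodule.mem_bot S).mp (h ▸ hf))
  rw [bMax_def, bMax_def, adicOrder_algebraMap_eq_of_formallySmooth S S' f]
  obtain ⟨-, hfν, -⟩ := EssSmoothLevels.adicOrder_toNat_spec hf0 hf
  congr 1
  ext b
  exact and_congr_right fun hb => reaches_map_iff_of_corrections h𝔪 h𝔪0 hfν hcorr hb

end Descent

end JFlatEssSmooth

end Summit.ResolutionOfSingularities.ResolutionOfSingularities.Theorems

end
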